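import Literature.Topology.FourManifolds.ThetaFourKervaireMilnorBettiStep
import Literature.Topology.FourManifolds.SphereSurgeryPiOneKill
import Literature.Topology.FourManifolds.FramedSphereInNullCobordism
import Literature.Topology.FourManifolds.WhitneyEmbeddingInClass
import Literature.AlgebraicTopology.SingularHomology.HurewiczSpherical
import HarnessLib

/-!
# Kervaire–Milnor's Theorem 5.1 (`k = 2`) over the two framed-surgery inputs of §5

Topic `Literature/Topology/FourManifolds` (fact seat of
`Literature.Topology.FourManifolds.HomotopySphere.boundsContractible_of_nullCobordism_isStablyParallelizable_four`).
M. Kervaire, J. Milnor, *Groups of homotopy spheres I*, Ann. of Math. 77 (1963), §5.  After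
`ThetaFourKervaireMilnorBettiStep` (Lemmas 5.6, 5.7-duality, 5.8 discharged) and
`SphereSurgeryPiOneKill` (the `π₁`-bookkeeping of Thm. 5.5), the named fact is reduced here to the
two statements of DIFFERENTIAL TOPOLOGY that the printed proof imports (Lemma 5.3 = Whitney's
embedding theorem + Lemma 3.5, trivial normal bundle; Lemma 5.4 = Milnor's choice of the framing
keeping s-parallelizability, [17, Thm. 2] / Lemma 6.2), at `p = 1` and `p = 2` in a `5`-manifold,
both in the currency that Whitney's theorem produces — a framed sphere whose core is HOMOTOPIC AS A
MAP to a given map of the sphere — and nothing else (plain hypotheses; no named fact is introduced):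

* (`h1`) for `W⁵` compact connected s-parallelizable with `bW = Σ` and `f : S¹ → W`, a framed circle
  `ν : S¹ × ℝ⁴ ↪ W` with core homotopic to `f` and `χ(W, ν)` s-parallelizable;
* (`h2`) for `W⁵` compact simply connected s-parallelizable with `bW = Σ` and `f : S² → W`, a
  framed `2`-sphere `ν : S² × ℝ³ ↪ W` with core homotopic to `f` and `χ(W, ν)` s-parallelizable.

What is PROVED here on top of the tree:

* `exists_subsingleton_of_torsionStep_of_rankStep'` — the iteration of pp. 518–519
  (`RankTorsionKilling.lean`) in the form where the modification of the torsion step may be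
  performed on ANY non-zero class `λ` (not on the prescribed one): this is what the printed proof
  uses ("Choose φ … representing a nontrivial λ").
* `HomotopySphere.exists_framedSphere_zsmul_of_framedSpheres` — **Lemma 5.3 read on `H₂` through
  Hurewicz**: from `h2`, every `x ∈ H₂(W; ℤ)` of a simply connected `W` is `d • φ_*[S²]` for a
  framed imbedded `2`-sphere `φ` with s-parallelizable modification (spherical representability
  `exists_sphereMap_of_connected`, homotopy invariance, `H₂(S²) = ℤ[S²]`); for a PRIMITIVE `x`
  (`μ · x = 1`) necessarily `d = ±1`, so `x` itself is the class of the sphere.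
* `HomotopySphere.boundsContractible_of_nullCobordism_isStablyParallelizable_four_of_framedSpheres`
  — **the named fact GIVEN `h1` and `h2` only**, along the printed proof: component of `bW`
  (`exists_connectedSpace_isStablyParallelizable`), Thm. 5.5 (`exists_simplyConnectedSpace_of_circleSurgery`
  with `h1`), Lemma 5.7 (`exists_addEquiv_torsion_of_killFree` with the Assertion
  `nonempty_addEquiv_quotient_surgered_of_epi` and the duality
  `epi_ofAbsolute_complement_of_exists_dual`), the torsion step (Lemma 5.6
  `nonempty_quotient_addEquiv_quotient_surgered`, Lemma 5.8 `finrank_surgery_ne_of_even`), and the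
  duality conclusion `boundsContractible_of_isZero_singularHomology_le`.
* `NullCobordism.exists_simplyConnectedSpace_isStablyParallelizable_of_circleSurgery` — the
  hypothesis `h_simply` of `HCobordismThetaFiniteKMSurgery` / `SurgeryBelowMiddleDimension` (any
  dimension `≥ 4`) from the one-circle statement.
* `HomotopySphere.boundsContractible_of_nullCobordism_isStablyParallelizable_four_of_whitney_of_reframing`
  — the named fact GIVEN Whitney's embedding theorem in a homotopy class for `S¹, S² → W♭`
  (`hE₁`, `hE₂`) and Lemma 5.4 / 6.2 in re-framing form (`hF₁`, `hF₂`: a framed circle resp.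
  `2`-sphere can be re-framed, keeping its core, so that the modification is s-parallelizable):
  the glue of Lemma 5.3 (Lemma 3.4, normal framing, tube, collar push-in) being
  `FramedSphereInNullCobordism`.
* `HomotopySphere.boundsContractible_of_nullCobordism_isStablyParallelizable_four_of_reframing`
  — **the named fact GIVEN Lemma 5.4 (re-framing form) ONLY**: Whitney's theorem in a homotopy
  class is the tree's `exists_injective_immersion_homotopic_of_continuous`
  (`WhitneyEmbeddingInClass.lean`, `2k < 5` for `k = 1, 2`).

## References

* M. Kervaire, J. Milnor, *Groups of homotopy spheres I*, Ann. of Math. 77 (1963): Thm. 5.1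
  (p. 512), Lemmas 5.2–5.4 and Thm. 5.5 (pp. 513–514), Lemmas 5.6–5.8 (pp. 514–518), proof of
  Thm. 5.1 for `k` even (pp. 518–519). doi:10.2307/1970128 [KervaireMilnorAnnals1963]
* A. Hatcher, *Algebraic Topology* (2002), Thm. 4.32, Thm. 2.10. [HatcherAT2002]
-/

noncomputable section

open scoped Manifold ContDiff Topology
open Set Function CategoryTheory CategoryTheory.Limits AddSubgroup
open Literature.AlgebraicTopology.SingularHomology
open Literature.GroupTheory.FiniteAbelian

namespace Literature.Topology.FourManifolds

/-! ### The iteration of pp. 518–519 with a free choice of the class to be modified -/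

/-- **Kervaire–Milnor's iteration (pp. 518–519) with the torsion step on a class of our choice.**
Same statement and proof as `exists_subsingleton_of_torsionStep_of_rankStep`
(`RankTorsionKilling.lean`), except that the hypothesis `h568` — given a stage `i` whose group is a
non-trivial (finite) group, a modification `j` with `G i / ℤλ ≅ G j / ℤλ'` and a different rank —
may now be realised on ANY non-zero class `λ = x'` of `G i` rather than on a prescribed one
(printed proof: "Choose an imbedding … representing a nontrivial homology class `λ`").
[cite: KervaireMilnorAnnals1963, proof of Thm. 5.1 for k even (pp. 518–519)] -/
theorem exists_subsingleton_of_torsionStep_of_rankStep' {ι : Type*} {G : ι → Type*}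
    [∀ i, AddCommGroup (G i)] (P : ι → Prop) (hfin : ∀ i, P i → AddGroup.FG (G i))
    (h57 : ∀ i, P i → ∃ j, P j ∧ Nonempty (G j ≃+ AddCommGroup.torsion (G i)))
    (h568 : ∀ i, P i → (∃ x : G i, x ≠ 0) → ∃ j, P j ∧
      (∃ (x' : G i) (y : G j), x' ≠ 0 ∧ Nonempty (G i ⧸ zmultiples x' ≃+ G j ⧸ zmultiples y)) ∧
      Module.finrank ℤ (G j) ≠ Module.finrank ℤ (G i))
    {i : ι} (hi : P i) : ∃ j, P j ∧ Subsingleton (G j) := by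
  -- (A) a stage whose group is isomorphic to a torsion group is finite (it is finitely generated)
  have hA : ∀ {i j : ι}, P j → (G j ≃+ AddCommGroup.torsion (G i)) → Finite (G j) := by
    intro i j hj e
    haveI := hfin j hj
    refine AddCommGroup.finite_of_fg_torsion (G j) fun g => ?_
    have h1 : IsOfFinAddOrder (e g : G i) := (AddCommGroup.mem_torsion _).1 (e g).2
    have h2 : IsOfFinAddOrder (e g) := by
      rwa [← (AddCommGroup.torsion (G i)).subtype_injective.isOfFinAddOrder_iff
        (f := (AddCommGroup.torsion (G i)).subtype)]
    exact (e.injective.isOfFinAddOrder_iff (f := e.toAddMonoidHom)).1 h2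
  -- (B) "in two steps one can replace `H_kM` by a smaller group": induction on the order
  have hB : ∀ (m : ℕ) {j : ι}, P j → Finite (G j) → Nat.card (G j) = m →
      ∃ l, P l ∧ Subsingleton (G l) := by
    intro m
    induction m using Nat.strong_induction_on with
    | _ m ih =>
      intro j hj hfj hcard
      by_cases hs : Subsingleton (G j)
      · exact ⟨j, hj, hs⟩
      have hex : ∃ x : G j, x ≠ 0 := by
        by_contra h
        push Not at h
        exact hs ⟨fun a b => by rw [h a, h b]⟩
      -- the modification on some non-trivial `x` (Lemmas 5.6, 5.8)
      obtain ⟨j', hj', ⟨x, y, hx, ⟨e⟩⟩, hrank⟩ := h568 j hj hex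
      haveI hq : Finite (G j ⧸ zmultiples x) := inferInstance
      haveI hq' : Finite (G j' ⧸ zmultiples y) := Finite.of_equiv _ e.toEquiv
      have hinf : ¬Finite (G j') := fun hf =>
        hrank ((finrank_int_eq_zero_of_finite (G j')).trans
          (finrank_int_eq_zero_of_finite (G j)).symm)
      have hy : ¬IsOfFinAddOrder y := fun hy => hinf (finite_of_finite_quotient_zmultiples hy)
      have hf := injective_torsion_to_quotient_zmultiples hy
      haveI hft : Finite (AddCommGroup.torsion (G j')) := Finite.of_injective _ hf
      have hlt : Nat.card (AddCommGroup.torsion (G j')) < m := by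
        have h1 : Nat.card (AddCommGroup.torsion (G j')) ≤ Nat.card (G j ⧸ zmultiples x) :=
          (Nat.card_le_card_of_injective _ hf).trans_eq (Nat.card_congr e.toEquiv.symm)
        have h2 := (zmultiples x).card_eq_card_quotient_mul_card_addSubgroup
        have h3 : 1 < Nat.card (zmultiples x) := by
          rw [Finite.one_lt_card_iff_nontrivial]
          exact ⟨⟨⟨x, mem_zmultiples x⟩, 0, fun h => hx (congrArg Subtype.val h)⟩⟩
        have h4 : 0 < Nat.card (G j ⧸ zmultiples x) := Nat.card_pos
        rw [← hcard, h2]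
        nlinarith
      obtain ⟨j'', hj'', ⟨e'⟩⟩ := h57 j' hj'
      haveI : Finite (G j'') := hA hj'' e'
      exact ih _ hlt hj'' this ((Nat.card_congr e'.toEquiv).trans rfl)
  -- (C) "According to 5.7, we can assume that `H_kM` is a torsion group"
  obtain ⟨j₁, hj₁, ⟨e₁⟩⟩ := h57 i hi
  exact hB _ hj₁ (hA hj₁ e₁) rfl

/-! ### Thm. 5.5 for null-cobordisms from the one-circle statement -/

namespace NullCobordism

/-- **The hypothesis `h_simply` of the surgery reductions from the one-circle statement**
(Kervaire–Milnor 1963, Thm. 5.5, first step; `exists_simplyConnectedSpace_of_circleSurgery` with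
`Q = IsStablyParallelizable`): in dimension `n + 1 ≥ 4`, if every map `S¹ → W` into a connected
s-parallelizable null-cobordism `W` of `M` is homotopic to the core of a framed circle with
s-parallelizable modification, then every connected s-parallelizable null-cobordism of `M` may be
replaced by a simply connected s-parallelizable one.
[cite: KervaireMilnorAnnals1963, Thm. 5.5 (proof, p. 514)] -/
theorem exists_simplyConnectedSpace_isStablyParallelizable_of_circleSurgery {n : ℕ} (hn : 3 ≤ n)
    {M : Type} [TopologicalSpace M] [ChartedSpace (EuclideanSpace ℝ (Fin n)) M]
    [IsManifold (𝓡 n) ∞ M]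
    (h1 : ∀ c : NullCobordism n M, ConnectedSpace c.W → IsStablyParallelizable (𝓡∂ (n + 1)) c.W →
      ∀ f : C(Metric.sphere (0 : EuclideanSpace ℝ (Fin 2)) 1, c.W),
        ∃ (l : ℕ) (hkl : 1 + l = n) (ν : FramedSphereFamily (𝓡∂ (n + 1)) c.W Unit 1 (l + 1)),
          ν.sphereMap.Homotopic f ∧ IsStablyParallelizable (𝓡∂ (n + 1)) (c.surgery ν hkl).W)
    (c : NullCobordism n M) [ConnectedSpace c.W] (hc : IsStablyParallelizable (𝓡∂ (n + 1)) c.W) :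
    ∃ c₁ : NullCobordism n M, SimplyConnectedSpace c₁.W ∧
      IsStablyParallelizable (𝓡∂ (n + 1)) c₁.W :=
  exists_simplyConnectedSpace_of_circleSurgery hn
    (fun c : NullCobordism n M => IsStablyParallelizable (𝓡∂ (n + 1)) c.W) h1 c hc

end NullCobordism

/-! ### Lemma 5.3 read on `H₂` through Hurewicz, and Theorem 5.1 (`k = 2`) -/

namespace HomotopySphere

/-- **Spherical classes of `H₂(W; ℤ)` as multiples of classes of framed imbedded `2`-spheres**
(Kervaire–Milnor 1963, p. 514: "Since we may assume that `M` is `(k-1)`-connected … the homotopy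
group `πₖM` may be replaced by the homology group `HₖM`", with Lemma 5.3): if every map
`S² → W` is homotopic to the core of a framed `2`-sphere `ν` with `Q ν`, then every
`x ∈ H₂(W; ℤ)` of the simply connected `W` is `ν_*(d • [S²])` for such a `ν` and some `d : ℤ`
(`exists_sphereMap_of_connected`: `x = f_* θ`; `θ = d • [S²]`; homotopic maps induce the same
map on `H₂`). [cite: KervaireMilnorAnnals1963, Lemma 5.3 (p. 513) and p. 514] -/
theorem exists_framedSphere_zsmul_of_framedSpheres {W : Type} [TopologicalSpace W]
    [ChartedSpace (EuclideanHalfSpace (4 + 1)) W] [SimplyConnectedSpace W]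
    (Q : FramedSphereFamily (𝓡∂ (4 + 1)) W Unit 2 (2 + 1) → Prop)
    (h2 : ∀ f : C(Metric.sphere (0 : EuclideanSpace ℝ (Fin (2 + 1))) 1, W),
      ∃ ν : FramedSphereFamily (𝓡∂ (4 + 1)) W Unit 2 (2 + 1), ν.sphereMap.Homotopic f ∧ Q ν)
    (x : singularHomology ℤ ℤ W 2) :
    ∃ (ν : FramedSphereFamily (𝓡∂ (4 + 1)) W Unit 2 (2 + 1)) (d : ℤ),
      singularHomology.map ℤ ℤ ν.sphereMap 2 (d • (SphereProd.μS (le_refl 2)).fundamentalClass) = x ∧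
        Q ν := by
  obtain ⟨f, θ, hθ⟩ := exists_sphereMap_of_connected (X := W) 0 (fun k hk hk2 => by omega) x
  obtain ⟨ν, hhom, hQ⟩ := h2 f
  obtain ⟨d, hd⟩ : ∃ d : ℤ, d • (SphereProd.μS (le_refl 2)).fundamentalClass = θ :=
    mem_zmultiples_iff.1 (by rw [SphereProd.zmultiples_fundamentalClass_eq_top]; trivial)
  refine ⟨ν, d, ?_, hQ⟩
  rw [hd, singularHomology.map_eq_of_homotopic ℤ ℤ hhom 2, hθ]

/-- **Kervaire–Milnor's Thm. 5.1 at `k = 2` from the two framed-surgery statements of §5.** The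
named fact `boundsContractible_of_nullCobordism_isStablyParallelizable_four` — every homotopy
`4`-sphere bounding a compact s-parallelizable `5`-manifold bounds a contractible one — GIVEN only:
* `h1` — **Lemmas 5.3–5.4 at `p = 1`** (with Whitney's theorem): in a compact connected
  s-parallelizable `W⁵` with `bW = Σ`, every map `S¹ → W` is homotopic to the core of a framed
  circle `φ : S¹ × ℝ⁴ ↪ W` with `χ(W, φ)` s-parallelizable;
* `h2` — **Lemmas 5.3–5.4 at `p = 2`**: in a compact simply connected s-parallelizable `W⁵` with
  `bW = Σ`, every map `S² → W` is homotopic to the core of a framed `2`-sphere `φ : S² × ℝ³ ↪ W`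
  with `χ(W, φ)` s-parallelizable.
Everything else along the printed proof is a theorem of the tree: the component of `bW`, Thm. 5.5
(`SphereSurgeryPiOneKill`), Hurewicz (`exists_framedSphere_zsmul_of_framedSpheres`), Lemma 5.6
and the Assertion (`SphereSurgeryOddMiddleHomology`), the duality of Lemma 5.7
(`SphereCorePrimitive`), Lemma 5.8 for `k = 2` (`ThetaFourKervaireMilnorBettiStep`), the iteration
of pp. 518–519 (`exists_subsingleton_of_torsionStep_of_rankStep'`) and the Poincaré-duality
conclusion of p. 514 (`boundsContractible_of_isZero_singularHomology_le`).
[cite: KervaireMilnorAnnals1963, Thm. 5.1 (p. 512), proof §5 (pp. 513–519)] -/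
theorem boundsContractible_of_nullCobordism_isStablyParallelizable_four_of_framedSpheres
    (h1 : ∀ (S : HomotopySphere 4) (c : NullCobordism 4 S.carrier), ConnectedSpace c.W →
      IsStablyParallelizable (𝓡∂ (4 + 1)) c.W →
        ∀ f : C(Metric.sphere (0 : EuclideanSpace ℝ (Fin 2)) 1, c.W),
          ∃ ν : FramedSphereFamily (𝓡∂ (4 + 1)) c.W Unit 1 (3 + 1),
            ν.sphereMap.Homotopic f ∧ IsStablyParallelizable (𝓡∂ (4 + 1)) (c.surgery ν rfl).W)
    (h2 : ∀ (S : HomotopySphere 4) (c : NullCobordism 4 S.carrier), SimplyConnectedSpace c.W →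
      IsStablyParallelizable (𝓡∂ (4 + 1)) c.W →
        ∀ f : C(Metric.sphere (0 : EuclideanSpace ℝ (Fin (2 + 1))) 1, c.W),
          ∃ ν : FramedSphereFamily (𝓡∂ (4 + 1)) c.W Unit 2 (2 + 1),
            ν.sphereMap.Homotopic f ∧ IsStablyParallelizable (𝓡∂ (4 + 1)) (c.surgery ν rfl).W) :
    boundsContractible_of_nullCobordism_isStablyParallelizable_four := by
  intro S c hpar
  haveI : ConnectedSpace S.carrier := HomotopySphere.connectedSpace (by norm_num) S
  -- (0) the component of `bW`
  obtain ⟨c₀, hc₀, hpar₀⟩ := c.exists_connectedSpace_isStablyParallelizable hpar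
  -- (1) Thm. 5.5: a simply connected, s-parallelizable `W₁` (circle surgeries, `h1`)
  haveI := hc₀
  obtain ⟨c₁, hsc₁, hpar₁⟩ :=
    NullCobordism.exists_simplyConnectedSpace_isStablyParallelizable_of_circleSurgery (n := 4)
      (by norm_num) (M := S.carrier)
      (fun c hc hQ f => by
        obtain ⟨ν, h, h'⟩ := h1 S c hc hQ f
        exact ⟨3, rfl, ν, h, h'⟩) c₀ hpar₀
  -- the Hypothesis of p. 516, kept by the modifications of `h2` (Lemma 5.4; `π₁` unchanged)
  let P : NullCobordism 4 S.carrier → Prop := fun c =>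
    SimplyConnectedSpace c.W ∧ IsStablyParallelizable (𝓡∂ (4 + 1)) c.W
  have hP : ∀ (c : NullCobordism 4 S.carrier), P c →
      ∀ ν : FramedSphereFamily (𝓡∂ (4 + 1)) c.W Unit 2 (2 + 1),
        IsStablyParallelizable (𝓡∂ (4 + 1)) (c.surgery ν rfl).W → P (c.surgery ν rfl) := by
    intro c hc ν hν
    haveI := hc.1
    exact ⟨FramedSphereFamily.simplyConnectedSpace_surgered ν rfl (by norm_num) le_rfl, hν⟩
  -- `H₂(W; ℤ)` is finitely generated
  have hfin : ∀ c : NullCobordism 4 S.carrier, P c → AddGroup.FG (singularHomology ℤ ℤ c.W 2) := by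
    intro c _
    have h := finite_singularHomology_of_compact_chartedSpace_halfSpace ℤ ℤ (n := 4) (W := c.W) 2
    exact Module.Finite.iff_addGroup_fg.1
      (by convert h using 2 <;> first | rfl | exact Subsingleton.elim _ _)
  -- Lemma 5.3 through Hurewicz: every class is `d • φ_*[S²]` for a framed `2`-sphere of `h2`
  set gen := (SphereProd.μS (le_refl 2)).fundamentalClass with hgen_def
  have hgen : zmultiples gen = ⊤ := SphereProd.zmultiples_fundamentalClass_eq_top (le_refl 2)
  have hrep : ∀ c : NullCobordism 4 S.carrier, P c → ∀ x : singularHomology ℤ ℤ c.W 2,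
      ∃ (ν : FramedSphereFamily (𝓡∂ (4 + 1)) c.W Unit 2 (2 + 1)) (d : ℤ),
        singularHomology.map ℤ ℤ ν.sphereMap 2 (d • gen) = x ∧
          IsStablyParallelizable (𝓡∂ (4 + 1)) (c.surgery ν rfl).W := by
    intro c hc x
    haveI := hc.1
    exact exists_framedSphere_zsmul_of_framedSpheres
      (fun ν => IsStablyParallelizable (𝓡∂ (4 + 1)) (c.surgery ν rfl).W) (h2 S c hc.1 hc.2) x
  -- (2)–(3a) Lemma 5.7: reduction of `H₂` to its torsion subgroup (a primitive class is the class
  -- of the sphere itself: `μ · (d λ) = 1` forces `d = ±1`)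
  have h57 : ∀ c : NullCobordism 4 S.carrier, P c → ∃ c₁ : NullCobordism 4 S.carrier, P c₁ ∧
      Nonempty (singularHomology ℤ ℤ c₁.W 2 ≃+ AddCommGroup.torsion (singularHomology ℤ ℤ c.W 2)) :=
    fun c hc => exists_addEquiv_torsion_of_killFree
      (G := fun c : NullCobordism 4 S.carrier => singularHomology ℤ ℤ c.W 2) P hfin
      (fun c hc x f hfx => by
        haveI := hc.1
        obtain ⟨ν, d, hx, hpar'⟩ := hrep c hc x
        -- `d = ±1`
        have hd : d * f (singularHomology.map ℤ ℤ ν.sphereMap 2 gen) = 1 := by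
          rw [← hfx, ← hx, map_zsmul, map_zsmul, smul_eq_mul]
        have hθ : zmultiples (d • gen) = ⊤ := by
          rcases Int.eq_one_or_neg_one_of_mul_eq_one hd with rfl | rfl
          · rwa [one_zsmul]
          · rw [neg_one_zsmul, zmultiples_neg]; exact hgen
        subst hx
        obtain ⟨e⟩ := FramedSphereFamily.nonempty_addEquiv_quotient_surgered_of_epi (X := c.W) ν
          rfl le_rfl hθ (NullCobordism.epi_ofAbsolute_complement_of_exists_dual S c ν rfl le_rfl
            two_ne_zero (by norm_num) hθ ⟨f, hfx⟩)
        exact ⟨c.surgery ν rfl, hP c hc ν hpar', ⟨e⟩⟩) hc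
  -- (2)–(3b) Lemmas 5.6, 5.8 on a non-trivial class `λ = φ_*[S²]`, and the iteration
  obtain ⟨c₂, ⟨hsc₂, -⟩, hH₂⟩ :=
    exists_subsingleton_of_torsionStep_of_rankStep'
      (G := fun c : NullCobordism 4 S.carrier => singularHomology ℤ ℤ c.W 2) P hfin h57
      (fun c hc hex => by
        haveI := hc.1
        obtain ⟨x, hx⟩ := hex
        obtain ⟨ν, d, hx', hpar'⟩ := hrep c hc x
        -- `λ = φ_*[S²] ≠ 0` since `x = d • λ ≠ 0`
        have hl : singularHomology.map ℤ ℤ ν.sphereMap 2 gen ≠ 0 := by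
          intro h0
          apply hx
          rw [← hx', map_zsmul, h0, zsmul_zero]
        obtain ⟨e⟩ := FramedSphereFamily.nonempty_quotient_addEquiv_quotient_surgered
          (X := c.W) ν rfl le_rfl hgen
        exact ⟨c.surgery ν rfl, hP c hc ν hpar', ⟨_, _, hl, ⟨e⟩⟩,
          by convert NullCobordism.finrank_surgery_ne_of_even le_rfl even_two S c ν using 2 <;>
            exact Subsingleton.elim _ _⟩)
      ⟨hsc₁, hpar₁⟩
  -- (4) "It will then follow from the Poincaré duality theorem that `M₁` is contractible"
  haveI := hsc₂
  refine boundsContractible_of_isZero_singularHomology_le (k := 2) (by norm_num) (by norm_num) S c₂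
    fun i hi hik => ?_
  rcases (show i = 1 ∨ i = 2 by omega) with rfl | rfl
  · exact isZero_singularHomology_one_of_simplyConnectedSpace ℤ ℤ
  · haveI := hH₂
    exact ModuleCat.isZero_of_subsingleton _

/-- **Kervaire–Milnor's Thm. 5.1 at `k = 2` over Whitney's embedding theorem and Lemma 5.4.**
The named fact GIVEN, for compact connected s-parallelizable null-cobordisms `W⁵` of homotopy
`4`-spheres:
* `hE₁`, `hE₂` — **Whitney's embedding theorem in a homotopy class** (Whitney 1936; Hirsch 1976,
  Thm. 2.2.13; used on p. 513: "Since `n ≥ 2p + 1` it follows from a well known theorem of Whitney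
  that `λ` can be represented by an imbedding") for maps of `S¹`, resp. `S²`, into the interior
  `W♭` (a non-compact boundaryless `5`-manifold): every continuous map is homotopic to a `C^∞`
  injective immersion;
* `hF₁`, `hF₂` — **Lemma 5.4** (p. 514, via Milnor [17, Thm. 2] or Lemma 6.2: "The imbedding
  `φ` can be chosen within its homotopy class so that the modified manifold `χ(M, φ)` will also
  be s-parallelizable") in re-framing form: every framed circle, resp. framed `2`-sphere, in `W`
  can be re-framed with the same core so that the modification is s-parallelizable.
The passage from an imbedded sphere to a framed one (Lemma 5.3: Lemma 3.4, Lemma 3.5, tubular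
neighbourhood, collar) is `FramedSphereInNullCobordism`; the rest is
`boundsContractible_of_nullCobordism_isStablyParallelizable_four_of_framedSpheres`.
[cite: KervaireMilnorAnnals1963, Thm. 5.1 (p. 512), Lemmas 5.3–5.4 (pp. 513–514)] -/
theorem boundsContractible_of_nullCobordism_isStablyParallelizable_four_of_whitney_of_reframing
    (hE₁ : ∀ (S : HomotopySphere 4) (c : NullCobordism 4 S.carrier), ConnectedSpace c.W →
      IsStablyParallelizable (𝓡∂ (4 + 1)) c.W →
        ∀ g : C(Metric.sphere (0 : EuclideanSpace ℝ (Fin (1 + 1))) 1, InteriorManifold (𝓡∂ (4 + 1)) c.W),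
          ∃ e : Metric.sphere (0 : EuclideanSpace ℝ (Fin (1 + 1))) 1 → InteriorManifold (𝓡∂ (4 + 1)) c.W,
            ContMDiff (𝓡 1) 𝓘(ℝ, EuclideanSpace ℝ (Fin (4 + 1))) ∞ e ∧
            (∀ u, Injective (mfderiv (𝓡 1) 𝓘(ℝ, EuclideanSpace ℝ (Fin (4 + 1))) e u)) ∧
            Injective e ∧ ∃ he : Continuous e, (⟨e, he⟩ : C(_, _)).Homotopic g)
    (hE₂ : ∀ (S : HomotopySphere 4) (c : NullCobordism 4 S.carrier), ConnectedSpace c.W →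
      IsStablyParallelizable (𝓡∂ (4 + 1)) c.W →
        ∀ g : C(Metric.sphere (0 : EuclideanSpace ℝ (Fin (2 + 1))) 1, InteriorManifold (𝓡∂ (4 + 1)) c.W),
          ∃ e : Metric.sphere (0 : EuclideanSpace ℝ (Fin (2 + 1))) 1 → InteriorManifold (𝓡∂ (4 + 1)) c.W,
            ContMDiff (𝓡 2) 𝓘(ℝ, EuclideanSpace ℝ (Fin (4 + 1))) ∞ e ∧
            (∀ u, Injective (mfderiv (𝓡 2) 𝓘(ℝ, EuclideanSpace ℝ (Fin (4 + 1))) e u)) ∧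
            Injective e ∧ ∃ he : Continuous e, (⟨e, he⟩ : C(_, _)).Homotopic g)
    (hF₁ : ∀ (S : HomotopySphere 4) (c : NullCobordism 4 S.carrier), ConnectedSpace c.W →
      IsStablyParallelizable (𝓡∂ (4 + 1)) c.W →
        ∀ ν : FramedSphereFamily (𝓡∂ (4 + 1)) c.W Unit 1 (3 + 1),
          ∃ ν' : FramedSphereFamily (𝓡∂ (4 + 1)) c.W Unit 1 (3 + 1), ν'.sphereMap = ν.sphereMap ∧
            IsStablyParallelizable (𝓡∂ (4 + 1)) (c.surgery ν' rfl).W)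
    (hF₂ : ∀ (S : HomotopySphere 4) (c : NullCobordism 4 S.carrier), SimplyConnectedSpace c.W →
      IsStablyParallelizable (𝓡∂ (4 + 1)) c.W →
        ∀ ν : FramedSphereFamily (𝓡∂ (4 + 1)) c.W Unit 2 (2 + 1),
          ∃ ν' : FramedSphereFamily (𝓡∂ (4 + 1)) c.W Unit 2 (2 + 1), ν'.sphereMap = ν.sphereMap ∧
            IsStablyParallelizable (𝓡∂ (4 + 1)) (c.surgery ν' rfl).W) :
    boundsContractible_of_nullCobordism_isStablyParallelizable_four := by
  refine boundsContractible_of_nullCobordism_isStablyParallelizable_four_of_framedSpheres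
    (fun S c hc hpar f => ?_) (fun S c hsc hpar f => ?_)
  · haveI := hc
    haveI : ConnectedSpace S.carrier := HomotopySphere.connectedSpace (by norm_num) S
    obtain ⟨ν, hν⟩ := NullCobordism.exists_framedSphereFamily_sphereMap_homotopic_of_whitney
      (n := 3) (k := 1) (l := 3) rfl (by norm_num) c hpar (hE₁ S c hc hpar) f
    obtain ⟨ν', hν', hpar'⟩ := hF₁ S c hc hpar ν
    exact ⟨ν', hν' ▸ hν, hpar'⟩
  · haveI := hsc
    haveI : ConnectedSpace S.carrier := HomotopySphere.connectedSpace (by norm_num) S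
    obtain ⟨ν, hν⟩ := NullCobordism.exists_framedSphereFamily_sphereMap_homotopic_of_whitney
      (n := 3) (k := 2) (l := 2) rfl (by norm_num) c hpar (hE₂ S c inferInstance hpar) f
    obtain ⟨ν', hν', hpar'⟩ := hF₂ S c hsc hpar ν
    exact ⟨ν', hν' ▸ hν, hpar'⟩

attribute [local instance] fact_finrank_euclideanSpace_succ in
/-- **Whitney's embedding theorem in a homotopy class for `k`-spheres in the interior of a
`5`-dimensional null-cobordism, `k ≤ 2`** (the tree's
`exists_injective_immersion_homotopic_of_continuous`, `2k < 5`), in the shape consumed by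
`FramedSphereInNullCobordism`. [cite: HirschDT1976, Ch. 2 §2 Thm. 2.13] -/
theorem exists_injective_immersion_homotopic_interior_five {k : ℕ} (hk : 2 * k < 4 + 1)
    {M : Type} [TopologicalSpace M] [ChartedSpace (EuclideanSpace ℝ (Fin 4)) M]
    (c : NullCobordism 4 M)
    (g : C(Metric.sphere (0 : EuclideanSpace ℝ (Fin (k + 1))) 1, InteriorManifold (𝓡∂ (4 + 1)) c.W)) :
    ∃ e : Metric.sphere (0 : EuclideanSpace ℝ (Fin (k + 1))) 1 → InteriorManifold (𝓡∂ (4 + 1)) c.W,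
      ContMDiff (𝓡 k) 𝓘(ℝ, EuclideanSpace ℝ (Fin (4 + 1))) ∞ e ∧
      (∀ u, Injective (mfderiv (𝓡 k) 𝓘(ℝ, EuclideanSpace ℝ (Fin (4 + 1))) e u)) ∧
      Injective e ∧ ∃ he : Continuous e, (⟨e, he⟩ : C(_, _)).Homotopic g := by
  have hk' : 2 * k < Module.finrank ℝ (EuclideanSpace ℝ (Fin (4 + 1))) := by simpa using hk
  obtain ⟨e, he, hinj, himm, hge⟩ := exists_injective_immersion_homotopic_of_continuous hk' g
  refine ⟨e, he, himm, hinj, e.continuous, ?_⟩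
  have hee : (⟨e, e.continuous⟩ : C(_, _)) = e := by
    ext u
    rfl
  rw [hee]
  exact hge.symm

/-- **Kervaire–Milnor's Thm. 5.1 at `k = 2` over Lemma 5.4 alone.**  The named fact
`boundsContractible_of_nullCobordism_isStablyParallelizable_four` GIVEN only Kervaire–Milnor's
**Lemma 5.4** (p. 514: "The imbedding `φ : Sᵖ × Dⁿ⁻ᵖ → M` can be chosen within its homotopy class
so that the modified manifold `χ(M, φ)` will also be s-parallelizable"; proof via Milnor [17,
Thm. 2] or Lemma 6.2, p. 522) at `p = 1` and `p = 2` in dimension `5`, in re-framing form: every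
framed circle (`hF₁`), resp. framed `2`-sphere in a simply connected `W` (`hF₂`), in a compact
connected s-parallelizable null-cobordism `W⁵` of a homotopy `4`-sphere can be re-framed, keeping
its core, so that the modification is s-parallelizable.  Whitney's embedding theorem (Lemma 5.3,
first half) is now the tree's `exists_injective_immersion_homotopic_of_continuous`; everything
else is `boundsContractible_of_nullCobordism_isStablyParallelizable_four_of_whitney_of_reframing`.
[cite: KervaireMilnorAnnals1963, Thm. 5.1 (p. 512), Lemma 5.4 (p. 514), Lemma 6.2 (p. 522)] -/
theorem boundsContractible_of_nullCobordism_isStablyParallelizable_four_of_reframing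
    (hF₁ : ∀ (S : HomotopySphere 4) (c : NullCobordism 4 S.carrier), ConnectedSpace c.W →
      IsStablyParallelizable (𝓡∂ (4 + 1)) c.W →
        ∀ ν : FramedSphereFamily (𝓡∂ (4 + 1)) c.W Unit 1 (3 + 1),
          ∃ ν' : FramedSphereFamily (𝓡∂ (4 + 1)) c.W Unit 1 (3 + 1), ν'.sphereMap = ν.sphereMap ∧
            IsStablyParallelizable (𝓡∂ (4 + 1)) (c.surgery ν' rfl).W)
    (hF₂ : ∀ (S : HomotopySphere 4) (c : NullCobordism 4 S.carrier), SimplyConnectedSpace c.W →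
      IsStablyParallelizable (𝓡∂ (4 + 1)) c.W →
        ∀ ν : FramedSphereFamily (𝓡∂ (4 + 1)) c.W Unit 2 (2 + 1),
          ∃ ν' : FramedSphereFamily (𝓡∂ (4 + 1)) c.W Unit 2 (2 + 1), ν'.sphereMap = ν.sphereMap ∧
            IsStablyParallelizable (𝓡∂ (4 + 1)) (c.surgery ν' rfl).W) :
    boundsContractible_of_nullCobordism_isStablyParallelizable_four :=
  boundsContractible_of_nullCobordism_isStablyParallelizable_four_of_whitney_of_reframing
    (fun S c _ _ g => exists_injective_immersion_homotopic_interior_five (by norm_num) c g)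
    (fun S c _ _ g => exists_injective_immersion_homotopic_interior_five (by norm_num) c g)
    hF₁ hF₂

end HomotopySphere

end Literature.Topology.FourManifolds

end
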